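import Literature.AlgebraicGeometry.Frobenioids.Cor412Padic
import Literature.AlgebraicGeometry.Frobenioids.Cor411PadicTempered
import Literature.AnabelianGeometry.SemiGraphs.CosetCategoriesSlimTempered
import HarnessLib

/-!
# Frobenioids I, Corollary 4.12 at the `p`-adic Frobenioids over the tempered bases `D = 𝓑^temp(Π, Π°)⁰` of
# [FrdII] Example 1.3 — the local Frobenioids of [EtTh] / [IUTchI] live over such bases

Mochizuki, *The geometry of Frobenioids I*, Kyushu J. Math. **62** (2008), Corollary 4.12 p. 95
[cite: MochizukiFrdI2008, Cor. 4.12 p.95]; *The geometry of Frobenioids II*, Kyushu J. Math. **62** (2008),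
Example 1.3 (i) p. 11 ("`𝓑^temp(Π, Π°)⁰` … of FSM-type") and (iii) pp. 11–12: "when `F = ℚ_p`, if we set
`D := 𝓑^temp(Π, Π°)⁰`, then we obtain a functor `D → D₀` … which satisfies the hypotheses of Theorem 1.2, (i). That is
to say, in this case, the main results of the theory of [Mzk5] may be applied to the `p`-adic Frobenioids of Example
1.1, (ii)" [cite: MochizukiFrdII2008, Ex 1.3 (iii) pp.11-12]; [SemiAnbd] Rmk. 3.4.1 p. 36 (a temperoid is slim iff
temp-slim) [cite: MochizukiSemiAnbd2006, Rmk 3.4.1 p.36].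

PROOF-ONLY file (abc-iut cell, block F fact-proving wave, seat abc-iut-f-027 gen 2; node FrdI:Cor4.12 at the LOCAL
genuine data; sequel of `Cor412Padic.lean`, companion of abc-iut-w4-d109's `Thm49PadicTempered.lean` /
`Cor411PadicTempered.lean`), 0 definitions. For a topological group `Π` with an open subgroup `Π°` the small model
`RelCosetCat Π°` of `𝓑^temp(Π, Π°)⁰` is of FSM-type (abc-iut-L1-t4's `RelCosetCat.isOfFSMType`), so the monoid-data
and FSMFF inputs of `Cor412Padic.lean` are automatic; Cor. 4.12's "`D_i` Frobenius-slim" follows from "`D_i` slim"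
([FrdI] Def. 3.1 (i)), i.e. from slimness of `𝓑^temp(Π_i)⁰` (`RelCosetCat.isSlim_of_isSlim`), which holds for `Π_i`
slim PROFINITE (`isSlim_cosetCat_of_isSlimGroup`, [FrdI] §0) and for `Π_i` TEMPERED and temp-slim
(`CosetCat.isSlim_of_isSlimGroup_of_isTempered`, [SemiAnbd] Rmk. 3.4.1). Hence, for `p`-adic Frobenioid data
`d_i : PadicFrd.Datum (RelCosetCat Π°_i) p_i` (arbitrary primes and data) and EVERY equivalence `Ψ : C₁ ⥲ C₂`:

* `PadicFrd.cor412_padic_relCoset` — the typed `PreFrobenioidData.Cor412` at THE parameters, NO hypothesis;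
* `PadicFrd.cor412_conclusion_padic_relCoset` — its conclusion (the `1`-unique `Ψ⁰ : D₁ × ℕ_{≥1} ⥤ D₂ × ℕ_{≥1}`
  over `Ψ`, both composites rigid) given `𝓑^temp(Π_i)⁰` slim; `…_of_isSlimGroup` — for slim profinite `Π_i`, no
  further hypothesis; `…_of_isTempered` — for tempered temp-slim `Π_i`, no further hypothesis.

No statement of either paper is restated or strengthened; no new definition; nothing here bears on, or takes a
side on, [IUTchIII] Cor. 3.12 (typed ≠ proved elsewhere; here proved = kernel-checked).
-/

noncomputable section

namespace Literature.AlgebraicGeometry.Frobenioids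

open CategoryTheory Opposite
open PreFrobenioid PreFrobenioidData Literature.AnabelianGeometry.SemiGraphs

namespace PadicFrd

section Tempered

variable {P₁ : Type} [Group P₁] [TopologicalSpace P₁] [IsTopologicalGroup P₁] (P₀₁ : OpenSubgroup P₁)
variable {P₂ : Type} [Group P₂] [TopologicalSpace P₂] [IsTopologicalGroup P₂] (P₀₂ : OpenSubgroup P₂)
variable {p₁ p₂ : ℕ} [Fact p₁.Prime] [Fact p₂.Prime]
variable (d₁ : Datum (RelCosetCat P₀₁) p₁) (d₂ : Datum (RelCosetCat P₀₂) p₂)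

/-- **[FrdI] Cor. 4.12 AS TYPED for `p`-adic Frobenioids over tempered bases `𝓑^temp(Π_i, Π°_i)⁰`, every
equivalence `Ψ`, at THE Def. 4.5 (iii) parameters — no hypothesis** (the bases are of FSM-type, [FrdII] Ex. 1.3
(i)/(iii), so `Φ_i`, `B_i` are monoids on `D_i` automatically).
[cite: MochizukiFrdI2008, Cor. 4.12 p.95] [cite: MochizukiFrdII2008, Ex 1.3 (iii) pp.11-12] -/
theorem cor412_padic_relCoset (Ψ : d₁.frobenioid ≌ d₂.frobenioid) :
    (ModelFrobenioid.data d₁.Φ d₁.B d₁.divB).Cor412 (ModelFrobenioid.data d₂.Φ d₂.B d₂.divB) Ψ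
      (rsParams (d₁.isFrobenioid_of_isMonoidData
          (d₁.isMonoidData_of_isOfFSMType (RelCosetCat.isOfFSMType P₀₁))) fun a 𝔭 => PrimarySupp a 𝔭)
      (rsParams (d₂.isFrobenioid_of_isMonoidData
          (d₂.isMonoidData_of_isOfFSMType (RelCosetCat.isOfFSMType P₀₂))) fun a 𝔭 => PrimarySupp a 𝔭) :=
  cor412_padic_of_isMonoidData d₁ d₂ (d₁.isMonoidData_of_isOfFSMType (RelCosetCat.isOfFSMType P₀₁))
    (d₂.isMonoidData_of_isOfFSMType (RelCosetCat.isOfFSMType P₀₂)) Ψ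

/-- **The conclusion of [FrdI] Cor. 4.12 for `p`-adic Frobenioids over tempered bases with slim `𝓑^temp(Π_i)⁰`**:
for every `Ψ : C₁ ⥲ C₂` there is a functor `Ψ⁰ : D₁ × ℕ_{≥1} ⥤ D₂ × ℕ_{≥1}` `1`-commuting with `Ψ` over the natural
projections `C_i → F_{0_{D_i}}`, `1`-unique with this property, and both composites `C₁ → D₂ × ℕ_{≥1}` are rigid
(slim ⇒ Frobenius-slim; rationally standard type by [FrdII] Thm. 1.2 (i); (b) idle).
[cite: MochizukiFrdI2008, Cor. 4.12 p.95] [cite: MochizukiFrdII2008, Ex 1.3 (iii) pp.11-12] -/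
theorem cor412_conclusion_padic_relCoset (hsl₁ : IsSlim (CosetCat P₁)) (hsl₂ : IsSlim (CosetCat P₂))
    (Ψ : d₁.frobenioid ≌ d₂.frobenioid) :
    ∃ Ψ0 : RelCosetCat P₀₁ × SingleObj ℕ+ ⥤ RelCosetCat P₀₂ × SingleObj ℕ+,
      OneUniqueSquare Ψ.functor (ModelFrobenioid.data d₁.Φ d₁.B d₁.divB).toBaseDeg
          (ModelFrobenioid.data d₂.Φ d₂.B d₂.divB).toBaseDeg Ψ0 ∧
        IsRigidFunctor (Ψ.functor ⋙ (ModelFrobenioid.data d₂.Φ d₂.B d₂.divB).toBaseDeg) ∧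
          IsRigidFunctor ((ModelFrobenioid.data d₁.Φ d₁.B d₁.divB).toBaseDeg ⋙ Ψ0) :=
  cor412_conclusion_padic_of_isOfFSMType d₁ d₂ (RelCosetCat.isOfFSMType P₀₁) (RelCosetCat.isOfFSMType P₀₂)
    (RelCosetCat.isSlim_of_isSlim P₀₁ hsl₁) (RelCosetCat.isSlim_of_isSlim P₀₂ hsl₂) Ψ

/-- **The conclusion of [FrdI] Cor. 4.12 for `p`-adic Frobenioids over `𝓑^temp(Π_i, Π°_i)⁰` with `Π_i` TEMPERED and
temp-slim — no further hypothesis** ("`𝓑^temp(Π)⁰` is slim iff `Π` is temp-slim", [SemiAnbd] Rmk. 3.4.1, on the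
coset model: `CosetCat.isSlim_of_isSlimGroup_of_isTempered`). [cite: MochizukiFrdI2008, Cor. 4.12 p.95]
[cite: MochizukiSemiAnbd2006, Rmk 3.4.1 p.36] -/
theorem cor412_conclusion_padic_relCoset_of_isTempered (hG₁ : IsTempered P₁) (hZ₁ : IsSlimGroup P₁)
    (hG₂ : IsTempered P₂) (hZ₂ : IsSlimGroup P₂) (Ψ : d₁.frobenioid ≌ d₂.frobenioid) :
    ∃ Ψ0 : RelCosetCat P₀₁ × SingleObj ℕ+ ⥤ RelCosetCat P₀₂ × SingleObj ℕ+,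
      OneUniqueSquare Ψ.functor (ModelFrobenioid.data d₁.Φ d₁.B d₁.divB).toBaseDeg
          (ModelFrobenioid.data d₂.Φ d₂.B d₂.divB).toBaseDeg Ψ0 ∧
        IsRigidFunctor (Ψ.functor ⋙ (ModelFrobenioid.data d₂.Φ d₂.B d₂.divB).toBaseDeg) ∧
          IsRigidFunctor ((ModelFrobenioid.data d₁.Φ d₁.B d₁.divB).toBaseDeg ⋙ Ψ0) :=
  cor412_conclusion_padic_relCoset P₀₁ P₀₂ d₁ d₂ (CosetCat.isSlim_of_isSlimGroup_of_isTempered hG₁ hZ₁)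
    (CosetCat.isSlim_of_isSlimGroup_of_isTempered hG₂ hZ₂) Ψ

end Tempered

/-! ### Slim profinite `Π`: the slimness premise discharged ([FrdII] Ex. 1.1 (i) / Thm. 1.2 (iv)) -/

section Profinite

variable {P₁ : Type} [Group P₁] [TopologicalSpace P₁] [IsTopologicalGroup P₁] [CompactSpace P₁]
  [TotallyDisconnectedSpace P₁] (P₀₁ : OpenSubgroup P₁)
variable {P₂ : Type} [Group P₂] [TopologicalSpace P₂] [IsTopologicalGroup P₂] [CompactSpace P₂]
  [TotallyDisconnectedSpace P₂] (P₀₂ : OpenSubgroup P₂)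
variable {p₁ p₂ : ℕ} [Fact p₁.Prime] [Fact p₂.Prime]
variable (d₁ : Datum (RelCosetCat P₀₁) p₁) (d₂ : Datum (RelCosetCat P₀₂) p₂)

/-- **The conclusion of [FrdI] Cor. 4.12 for `p`-adic Frobenioids over `𝓑(Π_i, Π°_i)⁰` with `Π_i` SLIM PROFINITE
groups — no further hypothesis** (slimness of `𝓑(Π)⁰` from slimness of `Π`, [FrdI] §0; `isSlim_cosetCat_of_isSlimGroup`):
for every `Ψ : C₁ ⥲ C₂`, the `1`-unique `Ψ⁰` over `Ψ` with both composites rigid.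
[cite: MochizukiFrdI2008, Cor. 4.12 p.95] [cite: MochizukiFrdII2008, Thm 1.2 (iv) p.9] -/
theorem cor412_conclusion_padic_relCoset_of_isSlimGroup (hZ₁ : IsSlimGroup P₁) (hZ₂ : IsSlimGroup P₂)
    (Ψ : d₁.frobenioid ≌ d₂.frobenioid) :
    ∃ Ψ0 : RelCosetCat P₀₁ × SingleObj ℕ+ ⥤ RelCosetCat P₀₂ × SingleObj ℕ+,
      OneUniqueSquare Ψ.functor (ModelFrobenioid.data d₁.Φ d₁.B d₁.divB).toBaseDeg
          (ModelFrobenioid.data d₂.Φ d₂.B d₂.divB).toBaseDeg Ψ0 ∧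
        IsRigidFunctor (Ψ.functor ⋙ (ModelFrobenioid.data d₂.Φ d₂.B d₂.divB).toBaseDeg) ∧
          IsRigidFunctor ((ModelFrobenioid.data d₁.Φ d₁.B d₁.divB).toBaseDeg ⋙ Ψ0) :=
  cor412_conclusion_padic_relCoset P₀₁ P₀₂ d₁ d₂ (isSlim_cosetCat_of_isSlimGroup hZ₁)
    (isSlim_cosetCat_of_isSlimGroup hZ₂) Ψ

end Profinite

end PadicFrd

end Literature.AlgebraicGeometry.Frobenioids

end
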